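import Literature.AlgebraicGeometry.Motives.WeightOneHodgeStructureOfPeriodCM
import Literature.AlgebraicGeometry.HodgeTheory.AbelianVarietyHodgeEssentialImageRecord
import HarnessLib

/-!
# Morphisms between the weight-one Hodge structures of two periods: `V¹_τ ≅ V¹_τ'` iff `τ' ∈ GL₂(ℚ) · τ`

For period vectors `ω = (1, τ)`, `ω' = (1, τ')` in `ℂ ⊗_ℚ ℚ²` (`τ, τ' ∉ ℝ`) and the weight-one `ℚ`-Hodge structures
`V¹_τ = ofSplitting (ℂ ∙ ω) hP one_pos`, `V¹_τ' = ofSplitting (ℂ ∙ ω') hP' one_pos` on `ℚ²` (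
`Motives/WeightOneHodgeStructureOfPeriod`):

* §1 `map_F_le_iff_rel₂` — a `ℚ`-linear `M : ℚ² → ℚ²` underlies a morphism `V¹_τ → V¹_τ'` iff `M_ℂ ω ∈ ℂ ω'` iff
  `m₁₀ + m₁₁ τ = τ' (m₀₀ + m₀₁ τ)` (`m_{ji} = (M eᵢ)_j`; then `M_ℂ ω = (m₀₀ + m₀₁ τ) ω'`);
* §2 `hom_eq_zero_of_coeff_eq_zero`, **`hom_bijective_of_ne_zero`** — a morphism `V¹_τ → V¹_τ'` is `0` or an
  ISOMORPHISM (rank-two weight-one Hodge structures with `h^{1,0} = 1` are simple);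
* §3 **`exists_hom_ne_zero_iff`** — a non-zero morphism (equivalently an isomorphism, `exists_hom_bijective_iff`)
  `V¹_τ → V¹_τ'` exists iff **`τ' (a + b τ) = c + d τ` for some rationals `a, b, c, d` with `a + b τ ≠ 0`**, i.e.
  `τ' = (c + dτ)/(a + bτ) ∈ GL₂(ℚ) · τ`; the relation is symmetric (`exists_hom_ne_zero_comm`); instances
  `τ' = τ + r`, `τ' = r τ`, `τ' = -1/τ` (`exists_hom_bijective_add_ratCast`, `…_ratCast_mul`, `…_neg_inv`).

This is the Hodge-theoretic form of the classical statement «`ℂ/(ℤ + τℤ)` and `ℂ/(ℤ + τ'ℤ)` are isogenous iff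
`τ' = (aτ + b)/(cτ + d)` with `(a b; c d) ∈ GL₂(ℚ)`» (Silverman AEC VI §4–5 / Lange–Birkenhake §1.2 for the
lattice side, NOT used here); with Moonen–Zarhin Lemma (3.3) (`Hom(E, E') ⊗ ℚ = Hom_HS(H¹E', H¹E)`, Riemann) the
abelian-variety reading is the Summits-side `CorCM/Assembly/EllipticCurvesOfPeriodsIsogenous` (for complex elliptic
curves via lattices see `NumberTheory/ComplexMultiplication/EllipticCurveIsogenyInvariants`).

References: [MoonenZarhin1999LowDim] Math. Ann. 315 (1999), §3 Lemma (3.3) · [LangeBirkenhake1992] §1.2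
Prop. 1.2.3, Thm. 4.2.1 · [SilvermanAEC2009] VI §4 Thm. 4.1, §5 · [DeligneHodgeII1971] 2.1.15, 2.3.5.

Provenance: Literature home (family `hodge`) of the Summits-side `CorCM/Geometry/WeightOneHodgeStructureOfPeriodIsogeny` (cell `pub-hodgecm2`, COR-CM assembly: complex elliptic curves through the weight-one Hodge structure of a period; all its imports are `Literature/` but the chain itself), which `Literature/` may not import; theorems only, no named fact, no definition. Nothing here bears on `HC_CM`; no case of the Hodge conjecture is proved. Lane `lit-hodgefound` (Layer A1/A3: weight-one Hodge structures, CM elliptic curves), seat p20.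
-/

noncomputable section

open scoped TensorProduct
open Module TensorProduct
open Literature.AlgebraicGeometry.Motives
open Literature.AlgebraicGeometry.Motives.HodgeStructure

namespace Literature.AlgebraicGeometry.Motives.PeriodHodgeStructure

section TwoPeriods

variable {τ τ' : ℂ} {ω ω' : ℂ ⊗[ℚ] (Fin 2 → ℚ)}
  (h0 : piScalarRight ℚ ℂ ℂ (Fin 2) ω 0 = 1) (h1 : piScalarRight ℚ ℂ ℂ (Fin 2) ω 1 = τ)
  (h0' : piScalarRight ℚ ℂ ℂ (Fin 2) ω' 0 = 1) (h1' : piScalarRight ℚ ℂ ℂ (Fin 2) ω' 1 = τ')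
  (hP : IsCompl (ℂ ∙ ω) (complexConj (ℂ ∙ ω))) (hP' : IsCompl (ℂ ∙ ω') (complexConj (ℂ ∙ ω')))

/-! ## §1 The criterion for a morphism `V¹_τ → V¹_τ'` -/

/-- **A `ℚ`-linear map underlies a morphism `V¹_τ → V¹_τ'` iff its complexification carries `ω` into the line `ℂ ω'`**
(`F⁰ = ⊤`, `F¹ = ℂ ω`, resp. `ℂ ω'`, `F² = ⊥`). [cite: MoonenZarhin1999LowDim, §3 Lemma (3.3)] -/
theorem map_F_le_iff_mem_span₂ (M : (Fin 2 → ℚ) →ₗ[ℚ] (Fin 2 → ℚ)) :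
    (∀ p : ℤ, ((ofSplitting (ℂ ∙ ω) hP one_pos : HodgeStructure (Fin 2 → ℚ) 1).F p).map (M.baseChange ℂ) ≤
        (ofSplitting (ℂ ∙ ω') hP' one_pos : HodgeStructure (Fin 2 → ℚ) 1).F p) ↔
      M.baseChange ℂ ω ∈ ℂ ∙ ω' := by
  constructor
  · intro h
    have h1' := h 1
    rw [F_one hP, F_one hP'] at h1'
    exact h1' ⟨ω, Submodule.mem_span_singleton_self _, rfl⟩
  · intro hω p
    by_cases hp : p ≤ 0
    · rw [ofSplitting_F (P := ℂ ∙ ω'), twoStepFiltration_of_le_zero _ hp]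
      exact le_top
    by_cases hp1 : p = 1
    · subst hp1
      rw [F_one hP, F_one hP', Submodule.map_le_iff_le_comap, Submodule.span_singleton_le_iff_mem,
        Submodule.mem_comap]
      exact hω
    · rw [F_of_two_le hP (by omega), F_of_two_le hP' (by omega), Submodule.map_bot]

include h0 h1 h0' h1' in
/-- **The criterion in coordinates**: `M_ℂ ω ∈ ℂ ω'` iff `m₁₀ + m₁₁ τ = τ' (m₀₀ + m₀₁ τ)` (`m_{ji} = (M eᵢ)_j`), and
then `M_ℂ ω = (m₀₀ + m₀₁ τ) ω'`. [cite: LangeBirkenhake1992, §1.2 Prop. 1.2.3] -/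
theorem mem_span_iff_rel₂ (M : (Fin 2 → ℚ) →ₗ[ℚ] (Fin 2 → ℚ)) :
    M.baseChange ℂ ω ∈ ℂ ∙ ω' ↔
      (M (Pi.single 0 1) 1 : ℂ) + (M (Pi.single 1 1) 1 : ℂ) * τ =
        τ' * ((M (Pi.single 0 1) 0 : ℂ) + (M (Pi.single 1 1) 0 : ℂ) * τ) := by
  rw [Submodule.mem_span_singleton]
  constructor
  · rintro ⟨l, hl⟩
    have e0 := congrArg (fun y => piScalarRight ℚ ℂ ℂ (Fin 2) y 0) hl
    have e1 := congrArg (fun y => piScalarRight ℚ ℂ ℂ (Fin 2) y 1) hl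
    simp only [coords_smul h0' h1', coords_baseChange h0 h1, Fin.isValue, if_true, one_ne_zero, if_false] at e0 e1
    rw [e0] at e1
    linear_combination -e1
  · intro hrel
    refine ⟨(M (Pi.single 0 1) 0 : ℂ) + (M (Pi.single 1 1) 0 : ℂ) * τ, ?_⟩
    apply (piScalarRight ℚ ℂ ℂ (Fin 2)).injective
    ext j
    rw [coords_smul h0' h1', coords_baseChange h0 h1]
    fin_cases j
    · simp
    · simp only [Fin.mk_one, Fin.isValue, one_ne_zero, if_false]
      linear_combination -hrel

include h0 h1 h0' h1' in
/-- **Hom criterion for two periods**: `M` underlies a morphism `V¹_τ → V¹_τ'` iff `m₁₀ + m₁₁ τ = τ' (m₀₀ + m₀₁ τ)`.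
[cite: MoonenZarhin1999LowDim, §3 Lemma (3.3)] [cite: LangeBirkenhake1992, §1.2 Prop. 1.2.3] -/
theorem map_F_le_iff_rel₂ (M : (Fin 2 → ℚ) →ₗ[ℚ] (Fin 2 → ℚ)) :
    (∀ p : ℤ, ((ofSplitting (ℂ ∙ ω) hP one_pos : HodgeStructure (Fin 2 → ℚ) 1).F p).map (M.baseChange ℂ) ≤
        (ofSplitting (ℂ ∙ ω') hP' one_pos : HodgeStructure (Fin 2 → ℚ) 1).F p) ↔
      (M (Pi.single 0 1) 1 : ℂ) + (M (Pi.single 1 1) 1 : ℂ) * τ =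
        τ' * ((M (Pi.single 0 1) 0 : ℂ) + (M (Pi.single 1 1) 0 : ℂ) * τ) :=
  (map_F_le_iff_mem_span₂ hP hP' M).trans (mem_span_iff_rel₂ h0 h1 h0' h1' M)

/-! ## §2 A morphism `V¹_τ → V¹_τ'` is zero or an isomorphism -/

include h0 h1 h0' h1' in
/-- For a morphism `S : V¹_τ → V¹_τ'`: `S_ℂ ω = (s₀₀ + s₀₁ τ) • ω'`. [cite: LangeBirkenhake1992, §1.2 Prop. 1.2.3] -/
theorem hom_baseChange_eq_smul
    (S : Hom (ofSplitting (ℂ ∙ ω) hP one_pos : HodgeStructure (Fin 2 → ℚ) 1) (ofSplitting (ℂ ∙ ω') hP' one_pos)) :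
    S.toLinearMap.baseChange ℂ ω =
      ((S.toLinearMap (Pi.single 0 1) 0 : ℂ) + (S.toLinearMap (Pi.single 1 1) 0 : ℂ) * τ) • ω' := by
  have hrel := (map_F_le_iff_rel₂ h0 h1 h0' h1' hP hP' S.toLinearMap).1 S.map_F_le
  apply (piScalarRight ℚ ℂ ℂ (Fin 2)).injective
  ext j
  rw [coords_smul h0' h1', coords_baseChange h0 h1]
  fin_cases j
  · simp
  · simp only [Fin.mk_one, Fin.isValue, one_ne_zero, if_false]
    linear_combination hrel

include h0 h1 h0' h1' in
/-- … and `S_ℂ ω̄ = conj (s₀₀ + s₀₁ τ) • ω̄'` (`S` is defined over `ℚ`). [cite: LangeBirkenhake1992, §1.2 Prop. 1.2.3] -/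
theorem hom_baseChange_conj_eq_smul
    (S : Hom (ofSplitting (ℂ ∙ ω) hP one_pos : HodgeStructure (Fin 2 → ℚ) 1) (ofSplitting (ℂ ∙ ω') hP' one_pos)) :
    S.toLinearMap.baseChange ℂ (conj ω) =
      starRingEnd ℂ ((S.toLinearMap (Pi.single 0 1) 0 : ℂ) + (S.toLinearMap (Pi.single 1 1) 0 : ℂ) * τ) •
        conj ω' := by
  rw [← conj_baseChange, hom_baseChange_eq_smul h0 h1 h0' h1' hP hP' S, conj_smul]

include h0 h1 h0' h1' in
/-- **A morphism `S : V¹_τ → V¹_τ'` with `s₀₀ + s₀₁ τ = 0` is zero** (`τ ∉ ℝ`: the rational coefficients vanish, then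
`s₁₀ + s₁₁ τ = τ' · 0 = 0` kills the second row). [cite: MoonenZarhin1999LowDim, §3 Lemma (3.3)] -/
theorem hom_eq_zero_of_coeff_eq_zero (hτ : τ.im ≠ 0)
    (S : Hom (ofSplitting (ℂ ∙ ω) hP one_pos : HodgeStructure (Fin 2 → ℚ) 1) (ofSplitting (ℂ ∙ ω') hP' one_pos))
    (hS : (S.toLinearMap (Pi.single 0 1) 0 : ℂ) + (S.toLinearMap (Pi.single 1 1) 0 : ℂ) * τ = 0) :
    S.toLinearMap = 0 := by
  set M := S.toLinearMap with hM
  have hrel := (map_F_le_iff_rel₂ h0 h1 h0' h1' hP hP' M).1 S.map_F_le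
  rw [hS, mul_zero] at hrel
  obtain ⟨h00, h01⟩ := rat_eq_zero_of_add_mul_eq_zero hτ hS
  obtain ⟨h10, h11⟩ := rat_eq_zero_of_add_mul_eq_zero hτ hrel
  apply (Pi.basisFun ℚ (Fin 2)).ext
  intro i
  ext j
  simp only [Pi.basisFun_apply, LinearMap.zero_apply, Pi.zero_apply]
  fin_cases i <;> fin_cases j
  · exact h00
  · exact h10
  · exact h01
  · exact h11

include h0 in
/-- The period vector `ω` is non-zero (its coordinate `0` is `1`). [cite: LangeBirkenhake1992, §1.2 and §4.2 Thm. 4.2.1] -/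
theorem periodVector_ne_zero : ω ≠ 0 := by
  intro h
  rw [h, map_zero, Pi.zero_apply] at h0
  exact zero_ne_one h0

include h0 in
/-- The conjugate period vector `ω̄` is non-zero. [cite: LangeBirkenhake1992, §1.2 and §4.2 Thm. 4.2.1] -/
theorem conj_periodVector_ne_zero : conj ω ≠ 0 := by
  intro h
  apply periodVector_ne_zero h0
  rw [← conj_conj ω, h, map_zero]

include hP in
/-- Every `x ∈ ℂ ⊗_ℚ ℚ²` is `a ω + b ω̄` (the splitting `hP`). [cite: LangeBirkenhake1992, §1.2 and §4.2 Thm. 4.2.1] -/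
theorem exists_eq_smul_add_smul_conj (x : ℂ ⊗[ℚ] (Fin 2 → ℚ)) : ∃ a b : ℂ, x = a • ω + b • conj ω := by
  have hx : x ∈ (ℂ ∙ ω) ⊔ complexConj (ℂ ∙ ω) := by rw [hP.sup_eq_top]; exact Submodule.mem_top
  obtain ⟨y, hy, z, hz, rfl⟩ := Submodule.mem_sup.1 hx
  obtain ⟨a, rfl⟩ := Submodule.mem_span_singleton.1 hy
  rw [complexConj_span_singleton] at hz
  obtain ⟨b, rfl⟩ := Submodule.mem_span_singleton.1 hz
  exact ⟨a, b, rfl⟩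

include h0 hP in
/-- In the splitting `ℂ² = ℂ ω ⊕ ℂ ω̄`: `a ω + b ω̄ = 0` forces `a = b = 0`. [cite: LangeBirkenhake1992, §1.2 and §4.2 Thm. 4.2.1] -/
theorem eq_zero_of_smul_add_smul_conj_eq_zero {a b : ℂ} (h : a • ω + b • conj ω = 0) : a = 0 ∧ b = 0 := by
  have ha : a • ω ∈ ℂ ∙ ω := Submodule.smul_mem _ _ (Submodule.mem_span_singleton_self _)
  have hb : b • conj ω ∈ complexConj (ℂ ∙ ω) := by
    rw [complexConj_span_singleton]; exact Submodule.smul_mem _ _ (Submodule.mem_span_singleton_self _)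
  have hab : a • ω = -(b • conj ω) := eq_neg_of_add_eq_zero_left h
  have hmem : a • ω ∈ (ℂ ∙ ω) ⊓ complexConj (ℂ ∙ ω) := ⟨ha, by rw [hab]; exact Submodule.neg_mem _ hb⟩
  rw [hP.inf_eq_bot, Submodule.mem_bot] at hmem
  have ha0 : a = 0 := by
    rcases smul_eq_zero.1 hmem with h' | h'
    · exact h'
    · exact absurd h' (periodVector_ne_zero h0)
  refine ⟨ha0, ?_⟩
  rw [ha0, zero_smul, zero_add] at h
  rcases smul_eq_zero.1 h with h' | h'
  · exact h'
  · exact absurd h' (conj_periodVector_ne_zero h0)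

include h0 h1 h0' h1' in
/-- **A non-zero morphism `V¹_τ → V¹_τ'` is an isomorphism** (`τ ∉ ℝ`): with `α = s₀₀ + s₀₁ τ ≠ 0`
(`hom_eq_zero_of_coeff_eq_zero`), `S_ℂ` maps the basis `ω, ω̄` to `α ω', ᾱ ω̄'`, so `S_ℂ`, hence `S`, is injective,
and an injective endomorphism of `ℚ²` is bijective.  (Rank-two weight-one Hodge structures are simple objects of
`Hod_ℚ`.) [cite: MoonenZarhin1999LowDim, §3 Lemma (3.3)] [cite: DeligneHodgeII1971, Thm. 2.3.5(iii)] -/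
theorem hom_bijective_of_ne_zero (hτ : τ.im ≠ 0)
    (S : Hom (ofSplitting (ℂ ∙ ω) hP one_pos : HodgeStructure (Fin 2 → ℚ) 1) (ofSplitting (ℂ ∙ ω') hP' one_pos))
    (hS : S.toLinearMap ≠ 0) : Function.Bijective S.toLinearMap := by
  set α : ℂ := (S.toLinearMap (Pi.single 0 1) 0 : ℂ) + (S.toLinearMap (Pi.single 1 1) 0 : ℂ) * τ with hα
  have hα0 : α ≠ 0 := fun h => hS (hom_eq_zero_of_coeff_eq_zero h0 h1 h0' h1' hP hP' hτ S h)
  -- `S_ℂ` is injective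
  have hinjC : Function.Injective (S.toLinearMap.baseChange ℂ) := by
    rw [injective_iff_map_eq_zero]
    intro x hx
    obtain ⟨a, b, rfl⟩ := exists_eq_smul_add_smul_conj hP x
    rw [map_add, map_smul, map_smul, hom_baseChange_eq_smul h0 h1 h0' h1' hP hP' S,
      hom_baseChange_conj_eq_smul h0 h1 h0' h1' hP hP' S, smul_smul, smul_smul] at hx
    obtain ⟨ha, hb⟩ := eq_zero_of_smul_add_smul_conj_eq_zero h0' hP' hx
    have ha' : a = 0 := (mul_eq_zero.1 ha).resolve_right hα0
    have hb' : b = 0 := (mul_eq_zero.1 hb).resolve_right fun h => hα0 ((map_eq_zero (starRingEnd ℂ)).1 h)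
    rw [ha', hb', zero_smul, zero_smul, add_zero]
  -- hence `S` is injective, hence bijective
  have hinj : Function.Injective S.toLinearMap := by
    intro v w hvw
    have h : S.toLinearMap.baseChange ℂ ((1 : ℂ) ⊗ₜ[ℚ] v) = S.toLinearMap.baseChange ℂ ((1 : ℂ) ⊗ₜ[ℚ] w) := by
      rw [LinearMap.baseChange_tmul, LinearMap.baseChange_tmul, hvw]
    have h' := hinjC h
    have := congrArg (piScalarRight ℚ ℂ ℂ (Fin 2)) h'
    funext i
    have hi := congrFun this i
    rw [coords_tmul, coords_tmul, mul_one, mul_one] at hi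
    exact_mod_cast hi
  exact ⟨hinj, LinearMap.injective_iff_surjective.1 hinj⟩

/-! ## §3 Existence: `V¹_τ ≅ V¹_τ'` iff `τ' ∈ GL₂(ℚ) · τ` -/

/-- `toLin' (a b; c d) e₀ = (a, c)` and `… e₁ = (b, d)`: the four matrix entries. [cite: LangeBirkenhake1992, §1.2 and §4.2 Thm. 4.2.1] -/
theorem toLin'_single_apply (a b c d : ℚ) :
    Matrix.toLin' !![a, b; c, d] (Pi.single 0 1) 0 = a ∧ Matrix.toLin' !![a, b; c, d] (Pi.single 1 1) 0 = b ∧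
      Matrix.toLin' !![a, b; c, d] (Pi.single 0 1) 1 = c ∧ Matrix.toLin' !![a, b; c, d] (Pi.single 1 1) 1 = d := by
  simp [Matrix.toLin'_apply, Matrix.mulVec, dotProduct, Fin.sum_univ_two]

include h0 h1 h0' h1' in
/-- **`V¹_τ → V¹_τ'` has a non-zero morphism iff `τ' (a + bτ) = c + dτ` for rationals with `a + bτ ≠ 0`**, i.e.
`τ' = (c + dτ)/(a + bτ) ∈ GL₂(ℚ) · τ` (`τ ∉ ℝ`).  `→`: the entries of `S` (`hom_eq_zero_of_coeff_eq_zero`); `←`: the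
matrix `(a b; c d)`. [cite: MoonenZarhin1999LowDim, §3 Lemma (3.3)] [cite: SilvermanAEC2009, VI §4 Thm. 4.1 and §5]
[cite: LangeBirkenhake1992, §1.2 Prop. 1.2.3] -/
theorem exists_hom_ne_zero_iff (hτ : τ.im ≠ 0) :
    (∃ S : Hom (ofSplitting (ℂ ∙ ω) hP one_pos : HodgeStructure (Fin 2 → ℚ) 1) (ofSplitting (ℂ ∙ ω') hP' one_pos),
        S.toLinearMap ≠ 0) ↔
      ∃ a b c d : ℚ, (a : ℂ) + b * τ ≠ 0 ∧ τ' * (a + b * τ) = c + d * τ := by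
  constructor
  · rintro ⟨S, hS⟩
    refine ⟨S.toLinearMap (Pi.single 0 1) 0, S.toLinearMap (Pi.single 1 1) 0, S.toLinearMap (Pi.single 0 1) 1,
      S.toLinearMap (Pi.single 1 1) 1, fun h => hS (hom_eq_zero_of_coeff_eq_zero h0 h1 h0' h1' hP hP' hτ S h), ?_⟩
    exact ((map_F_le_iff_rel₂ h0 h1 h0' h1' hP hP' S.toLinearMap).1 S.map_F_le).symm
  · rintro ⟨a, b, c, d, hab, hrel⟩
    obtain ⟨ea, eb, ec, ed⟩ := toLin'_single_apply a b c d
    refine ⟨⟨Matrix.toLin' !![a, b; c, d], (map_F_le_iff_rel₂ h0 h1 h0' h1' hP hP' _).2 ?_⟩, fun h => hab ?_⟩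
    · rw [ea, eb, ec, ed]
      exact hrel.symm
    · have h' : Matrix.toLin' !![a, b; c, d] = 0 := h
      rw [h', LinearMap.zero_apply, Pi.zero_apply] at ea eb
      rw [← ea, ← eb]
      simp

include h0 h1 h0' h1' in
/-- **`V¹_τ ≅ V¹_τ'` iff `τ' (a + bτ) = c + dτ` for rationals with `a + bτ ≠ 0`** (`τ ∉ ℝ`; a non-zero morphism is
an isomorphism, `hom_bijective_of_ne_zero`). [cite: MoonenZarhin1999LowDim, §3 Lemma (3.3)]
[cite: SilvermanAEC2009, VI §4 Thm. 4.1 and §5] -/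
theorem exists_hom_bijective_iff (hτ : τ.im ≠ 0) :
    (∃ S : Hom (ofSplitting (ℂ ∙ ω) hP one_pos : HodgeStructure (Fin 2 → ℚ) 1) (ofSplitting (ℂ ∙ ω') hP' one_pos),
        Function.Bijective S.toLinearMap) ↔
      ∃ a b c d : ℚ, (a : ℂ) + b * τ ≠ 0 ∧ τ' * (a + b * τ) = c + d * τ := by
  rw [← exists_hom_ne_zero_iff h0 h1 h0' h1' hP hP' hτ]
  constructor
  · rintro ⟨S, hS⟩
    refine ⟨S, fun h => ?_⟩
    have := hS.1 (show S.toLinearMap (Pi.single 0 1) = S.toLinearMap 0 by rw [h, map_zero]; rfl)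
    exact one_ne_zero (congrFun this 0)
  · rintro ⟨S, hS⟩
    exact ⟨S, hom_bijective_of_ne_zero h0 h1 h0' h1' hP hP' hτ S hS⟩

include h0 h1 h0' h1' in
/-- **The relation is symmetric**: a non-zero morphism `V¹_τ → V¹_τ'` exists iff one `V¹_τ' → V¹_τ` does (the
inverse of an isomorphism of Hodge structures is a morphism, `Hom.symmOfBijective`). [cite: DeligneHodgeII1971, Thm. 2.3.5(iii)] -/
theorem exists_hom_ne_zero_comm (hτ : τ.im ≠ 0) (hτ' : τ'.im ≠ 0) :
    (∃ S : Hom (ofSplitting (ℂ ∙ ω) hP one_pos : HodgeStructure (Fin 2 → ℚ) 1) (ofSplitting (ℂ ∙ ω') hP' one_pos),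
        S.toLinearMap ≠ 0) ↔
      ∃ S : Hom (ofSplitting (ℂ ∙ ω') hP' one_pos : HodgeStructure (Fin 2 → ℚ) 1) (ofSplitting (ℂ ∙ ω) hP one_pos),
        S.toLinearMap ≠ 0 := by
  constructor
  · rintro ⟨S, hS⟩
    have hb := hom_bijective_of_ne_zero h0 h1 h0' h1' hP hP' hτ S hS
    refine ⟨S.symmOfBijective hb, fun h => ?_⟩
    have := Hom.symmOfBijective_apply_apply S hb (Pi.single 0 1)
    rw [h, LinearMap.zero_apply] at this
    exact one_ne_zero (congrFun this 0).symm
  · rintro ⟨S, hS⟩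
    have hb := hom_bijective_of_ne_zero h0' h1' h0 h1 hP' hP hτ' S hS
    refine ⟨S.symmOfBijective hb, fun h => ?_⟩
    have := Hom.symmOfBijective_apply_apply S hb (Pi.single 0 1)
    rw [h, LinearMap.zero_apply] at this
    exact one_ne_zero (congrFun this 0).symm

include h0 h1 h0' h1' in
/-- **Translation by a rational**: `V¹_τ ≅ V¹_{τ + r}` for `r ∈ ℚ` (`(a b; c d) = (1 0; r 1)`). [cite: SilvermanAEC2009, VI §4 Thm. 4.1 and §5] -/
theorem exists_hom_bijective_add_ratCast (hτ : τ.im ≠ 0) (r : ℚ) (hτ' : τ' = τ + r) :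
    ∃ S : Hom (ofSplitting (ℂ ∙ ω) hP one_pos : HodgeStructure (Fin 2 → ℚ) 1) (ofSplitting (ℂ ∙ ω') hP' one_pos),
      Function.Bijective S.toLinearMap :=
  (exists_hom_bijective_iff h0 h1 h0' h1' hP hP' hτ).2 ⟨1, 0, r, 1, by simp, by rw [hτ']; push_cast; ring⟩

include h0 h1 h0' h1' in
/-- **Rational homothety**: `V¹_τ ≅ V¹_{r τ}` for `r ∈ ℚ` (then `r ≠ 0` as `τ' ∉ ℝ`; `(a b; c d) = (1 0; 0 r)`).
[cite: SilvermanAEC2009, VI §4 Thm. 4.1 and §5] -/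
theorem exists_hom_bijective_ratCast_mul (hτ : τ.im ≠ 0) (r : ℚ) (hτ' : τ' = r * τ) :
    ∃ S : Hom (ofSplitting (ℂ ∙ ω) hP one_pos : HodgeStructure (Fin 2 → ℚ) 1) (ofSplitting (ℂ ∙ ω') hP' one_pos),
      Function.Bijective S.toLinearMap :=
  (exists_hom_bijective_iff h0 h1 h0' h1' hP hP' hτ).2 ⟨1, 0, 0, r, by simp, by rw [hτ']; push_cast; ring⟩

include h0 h1 h0' h1' in
/-- **Inversion**: `V¹_τ ≅ V¹_{-1/τ}` (`(a b; c d) = (0 1; -1 0)`; with the two previous ones, invariance under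
`GL₂(ℚ)` acting by Möbius transformations). [cite: SilvermanAEC2009, VI §4 Thm. 4.1 and §5] -/
theorem exists_hom_bijective_neg_inv (hτ : τ.im ≠ 0) (hτ' : τ' = -τ⁻¹) :
    ∃ S : Hom (ofSplitting (ℂ ∙ ω) hP one_pos : HodgeStructure (Fin 2 → ℚ) 1) (ofSplitting (ℂ ∙ ω') hP' one_pos),
      Function.Bijective S.toLinearMap := by
  have hτ0 : τ ≠ 0 := fun h => hτ (by rw [h, Complex.zero_im])
  refine (exists_hom_bijective_iff h0 h1 h0' h1' hP hP' hτ).2 ⟨0, 1, -1, 0, by simpa using hτ0, ?_⟩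
  rw [hτ']
  push_cast
  field_simp
  ring

end TwoPeriods

end Literature.AlgebraicGeometry.Motives.PeriodHodgeStructure

end
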